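import Mathlib.RingTheory.PowerSeries.Binomial
import Mathlib.NumberTheory.Padics.MahlerBasis
import Mathlib.Algebra.Polynomial.Degree.Lemmas
import Summits.BirchSwinnertonDyer.BirchSwinnertonDyer.Theorems.SignedLowerHalvesSmallImageLowerHalfBothSignsRttE2NumNormLambda
import Summits.BirchSwinnertonDyer.BirchSwinnertonDyer.Theorems.ResidualThetaTransportAtTwoLambdaLowerBoundOEulerFactorUnitPower
import HarnessLib

/-!
# Route `SignedLowerHalves`, crux L `SmallImageLowerHalfBothSigns` (item stmt-BirchSwinnertonDyer-23599), line `rtt_w3` —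
# row **E2-num** of `Lines/rtt_w3-BRIEF-E2-g8.md` §2, part 3: the LOCAL EULER TERM `p^{v_p(f)}·layerLambda(P(u(1+X)))` and the
# norm-λ index of the full analytic product `C(c)·L·∏_v P_v(u_v·(1+T)^{f_v})`

Width seat `bsd-line-slh-p3-w3` g19 under LEAD `cruxlead-stmt-BirchSwinnertonDyer-23599` g8 (cell `bsd-ssimc`); ROUTE-INDEPENDENT
helper (`--supports stmt-BirchSwinnertonDyer-23599`); THEOREMS ONLY — no definition, no named fact, no instance, no `sorry`;
pure algebra of power series; nothing about any Selmer group, zeta element or modular form is asserted; closes nothing;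
BSD is not proved by any of this.

WHY. In the E2-tail of `stub_charRoad_ns` the place `v = (ℓ) ∈ S₀` contributes
`p ^ (frobeniusExponent p ℓ).valuation * layerLambda ((1 − C a_ℓ X + C c_ℓ X²).comp (C ℓ⁻¹ * (X + 1)))`; on the analytic
side of the LEAD's cut (BRIEF-E2 rev 2 §2, E2-an_Σ) the same place contributes the Euler-factor SERIES
`𝒫_v = P_{g,ℓ}(ℓ⁻¹·γ_ℓ) = P_{g,ℓ}(ℓ⁻¹(1+T)^{f_ℓ}) ∈ Λ_𝒪` (`γ_ℓ = γ^{f_ℓ}` the Frobenius in `Γ`, Greenberg–Vatsal §1 p. 9;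
the tree's `GreenbergVatsal2000.eulerFactorElement` shape). E2-num must identify the norm-λ index (first index of the
maximal coefficient norm = Weierstrass `λ`, any `μ`) of `𝒫_v` with that local term, and of the whole product
`c·L·∏_v 𝒫_v` with `d(L) + Σ_v (local terms)`. This file does exactly that, in `ℚ̄_p⟦T⟧` (coefficient-ring free), on top
of part 1 (`…RttE2NumNormLambda`: `normLambda_aeval`, `normLambda_mul/prod`) and RTT@2's residual computation of
`(B^{p^k} − 1) mod 𝔪` (`LambdaLowerBoundO.map_residue_pow_prime_pow`, `order_map_residue_sub_one_pow`):

* §1 `binomialSeries_natCast_mul` (`(1+T)^{n·r} = ((1+T)^r)ⁿ`), **`order_map_residue_binomialSeries_sub_one`**: for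
  `f ∈ ℤ_p ∖ 0`, `((1+T)^f − 1) mod p` has `T`-order `p^{v_p(f)}` (`f = u·p^k`, `(1+T)^f = ((1+T)^u)^{p^k}`, freshman's dream,
  `(1+T)^u − 1 = uT + …`); `normLambda_binomialSeries_sub_one`: hence along any norm-preserving `ℤ_p → A` the series
  `(1+T)^f − 1` attains its maximal coefficient norm `1` first at `p^{v_p(f)}`.
* §2 **`normLambda_aeval_C_mul_binomialSeries`**: over `ℚ̄_p`, for a polynomial `P ≠ 0`, `u ≠ 0` and `f ∈ ℤ_p ∖ 0`, the series
  `P(u·(1+T)^f) = aeval (C u · (1+T)^f) P` attains its maximal coefficient norm first at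
  `p^{v_p(f)} · layerLambda (P.comp (C u * (X + 1)))`, with value `‖P.comp (C u * (X + 1))‖_sup` (substitute `Y − 1`,
  `Y = (1+T)^f`, into `P(u(X+1))`).
* §3 **`normLambda_C_mul_mul_prod_aeval`**: the full product `C c · L · ∏_{v∈s} P_v(u_v·(1+T)^{f_v})` (`c ≠ 0`, `L ≠ 0` with
  norm-λ index `d`, all `P_v ≠ 0`, `u_v ≠ 0`, `f_v ≠ 0`) attains its maximal coefficient norm first at
  `d + Σ_{v∈s} p^{v_p(f_v)} · layerLambda (P_v.comp (C u_v * (X + 1)))` — the E2-tail's index VERBATIM once `u_v = ℓ_v⁻¹`,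
  `f_v = frobeniusExponent p ℓ_v`, `P_v = 1 − C (embCoeff g ι ℓ_v) X + C c_v X²`.
The module-side counts (`dim_E`, `dim_{ℚ_p}` of `Λ_𝒪/(·)`) then follow from part 2 (`…RttE2NumLambdaCount`) and RTT@2's
`finrank_*_quotient_span_eq_of_normLambda[_iwasawaAlgebraO]`.

References: [GreenbergVatsal2000] §1 p. 9, §2 Prop. (2.4) (`λ(𝒫_ℓ) = s_ℓ·d_ℓ`); [Washington1997] §7.1, Prop. 13.2.
-/

set_option autoImplicit false
-- the Theorems namespace of this sub repeats the summit name by design (D-0017 nested layout)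
set_option linter.dupNamespace false

noncomputable section

open PowerSeries Literature.NumberTheory.IwasawaTheory
open Summit.BirchSwinnertonDyer.BirchSwinnertonDyer.Theorems.LambdaLowerBoundO

namespace Summit.BirchSwinnertonDyer.BirchSwinnertonDyer.Theorems.SmallImageRttE2Num

/-! ## §1. `(1+T)^f − 1` reduces to a series of `T`-order `p^{v_p(f)}` -/

section Binomial

variable {p : ℕ} [Fact p.Prime]

/-- `(1+T)^{n·r} = ((1+T)^r)ⁿ` for the formal binomial series over a binomial ring (iterate `binomialSeries_add`).
[cite: Washington1997, Prop. 13.2] -/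
theorem binomialSeries_natCast_mul {R A : Type*} [CommRing R] [BinomialRing R] [CommRing A] [Algebra R A] (r : R)
    (n : ℕ) : binomialSeries A ((n : R) * r) = binomialSeries A r ^ n := by
  induction n with
  | zero => simp
  | succ n ih => rw [Nat.cast_succ, add_mul, one_mul, binomialSeries_add, ih, pow_succ]

/-- **`((1+T)^f − 1) mod p` has `T`-order `p^{v_p(f)}`** for `f ∈ ℤ_p`, `f ≠ 0`: with `f = u·p^k`, `u` a unit,
`(1+T)^f = B^{p^k}` for `B = (1+T)^u = 1 + uT + …`, and modulo `p` one has `B^{p^k} − 1 = (B̄ − 1)^{p^k}` of order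
`p^k·ord(B̄ − 1) = p^k` (this is the number `s_ℓ = p^{v_p(f_ℓ)}` of primes of `ℚ_∞` above `ℓ` when `f = f_ℓ`).
[cite: GreenbergVatsal2000, §2 Prop. (2.4)] [cite: Washington1997, Prop. 13.2] -/
theorem order_map_residue_binomialSeries_sub_one {f : ℤ_[p]} (hf : f ≠ 0) :
    ((binomialSeries ℤ_[p] f - 1).map (IsLocalRing.residue ℤ_[p])).order = ((p ^ f.valuation : ℕ) : ℕ∞) := by
  haveI : CharP (IsLocalRing.ResidueField ℤ_[p]) p :=
    charP_of_injective_ringHom (f := (PadicInt.residueField (p := p)).symm.toRingHom)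
      (PadicInt.residueField (p := p)).symm.injective p
  set u : ℤ_[p] := (PadicInt.unitCoeff hf : ℤ_[p]) with hu
  set k : ℕ := f.valuation with hk
  have hfac : f = ((p ^ k : ℕ) : ℤ_[p]) * u := by
    rw [Nat.cast_pow, mul_comm]; exact PadicInt.unitCoeff_spec hf
  set B : PowerSeries ℤ_[p] := binomialSeries ℤ_[p] u with hB
  have hpow : binomialSeries ℤ_[p] f = B ^ (p ^ k) := by rw [hfac, binomialSeries_natCast_mul]
  have hB0 : IsLocalRing.residue ℤ_[p] (constantCoeff B) = 1 := by
    rw [hB, binomialSeries_constantCoeff, map_one]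
  have hB1 : IsLocalRing.residue ℤ_[p] (coeff 1 B) ≠ 0 := by
    rw [hB, binomialSeries_coeff, Ring.choose_one_right, smul_eq_mul, mul_one, ne_eq,
      IsLocalRing.residue_eq_zero_iff]
    exact fun h ↦ (IsLocalRing.mem_maximalIdeal _).mp h (PadicInt.unitCoeff hf).isUnit
  rw [hpow, map_sub, map_one, map_residue_pow_prime_pow p k B, add_sub_cancel_left]
  exact order_map_residue_sub_one_pow p k hB0 hB1

/-- **`(1+T)^f − 1` in the norm currency**: along any norm-preserving ring map `ι₀ : ℤ_p → A`, the series
`((1+T)^f − 1)^{ι₀}` (`f ≠ 0`) has `p^{v_p(f)}`-th coefficient of norm `1`, all coefficients of norm at most that, and all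
earlier ones of strictly smaller norm. [cite: GreenbergVatsal2000, §2 Prop. (2.4)] -/
theorem normLambda_binomialSeries_sub_one {A : Type*} [NormedRing A] (ι₀ : ℤ_[p] →+* A) (hι₀ : ∀ x, ‖ι₀ x‖ = ‖x‖)
    {f : ℤ_[p]} (hf : f ≠ 0) :
    ‖coeff (p ^ f.valuation) ((binomialSeries ℤ_[p] f - 1).map ι₀)‖ = 1 ∧
      (∀ k, ‖coeff k ((binomialSeries ℤ_[p] f - 1).map ι₀)‖ ≤
        ‖coeff (p ^ f.valuation) ((binomialSeries ℤ_[p] f - 1).map ι₀)‖) ∧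
      ∀ k, k < p ^ f.valuation → ‖coeff k ((binomialSeries ℤ_[p] f - 1).map ι₀)‖ <
        ‖coeff (p ^ f.valuation) ((binomialSeries ℤ_[p] f - 1).map ι₀)‖ :=
  normLambda_map_of_order_map_residue_eq ι₀ hι₀ _ (order_map_residue_binomialSeries_sub_one hf)

end Binomial

/-! ## §2. The local Euler term over `ℚ̄_p`: `P(u·(1+T)^f)` has index `p^{v_p(f)}·layerLambda(P(u(X+1)))` -/

section Local

variable {p : ℕ} [Fact p.Prime]

/-- `P(u·Y) = R(Y − 1)` for `R = P.comp (C u * (X + 1))` (re-centring the local polynomial at `Y = 1`). [folklore] -/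
theorem aeval_C_mul_eq_aeval_sub_one_comp {K : Type*} [Field K] (P : Polynomial K) (u : K) (Y : PowerSeries K) :
    Polynomial.aeval (C u * Y) P = Polynomial.aeval (Y - 1) (P.comp (Polynomial.C u * (Polynomial.X + 1))) := by
  rw [Polynomial.aeval_comp]
  congr 1
  simp only [map_mul, Polynomial.aeval_C, map_add, Polynomial.aeval_X, map_one, sub_add_cancel]
  rfl

/-- `P.comp (C u * (X + 1)) ≠ 0` for `P ≠ 0`, `u ≠ 0` (composition with a polynomial of degree `1`). [folklore] -/
theorem comp_C_mul_X_add_one_ne_zero {K : Type*} [Field K] {P : Polynomial K} (hP : P ≠ 0) {u : K} (hu : u ≠ 0) :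
    P.comp (Polynomial.C u * (Polynomial.X + 1)) ≠ 0 := by
  have hdeg : (Polynomial.C u * (Polynomial.X + 1)).natDegree = 1 := by
    rw [Polynomial.natDegree_C_mul hu, ← Polynomial.C_1, Polynomial.natDegree_X_add_C]
  intro h
  rcases Polynomial.comp_eq_zero_iff.mp h with h0 | ⟨-, h1⟩
  · exact hP h0
  · have := congrArg Polynomial.natDegree h1
    rw [hdeg, Polynomial.natDegree_C] at this
    exact one_ne_zero this

/-- **The local Euler term.** For a polynomial `P ≠ 0` over `ℚ̄_p`, a scalar `u ≠ 0` and `f ∈ ℤ_p ∖ 0`, the power series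
`P(u·(1+T)^f) = aeval (C u · ((1+T)^f)^{ℚ̄_p}) P` attains its maximal coefficient norm FIRST at the index
`p^{v_p(f)} · layerLambda (P.comp (C u * (X + 1)))`, and that norm is `‖P.comp (C u * (X + 1))‖_sup`. With `u = ℓ⁻¹`,
`f = f_ℓ` and `P = P_{g,ℓ}` this is the `v = (ℓ)` summand of the E2-tail; in Greenberg–Vatsal's words
`λ(𝒫_ℓ) = s_ℓ·d_ℓ`. [cite: GreenbergVatsal2000, §2 Prop. (2.4)] [cite: Washington1997, §7.1] -/
theorem normLambda_aeval_C_mul_binomialSeries {P : Polynomial (PadicAlgCl p)} (hP : P ≠ 0) {u : PadicAlgCl p}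
    (hu : u ≠ 0) {f : ℤ_[p]} (hf : f ≠ 0) :
    ‖coeff (p ^ f.valuation * layerLambda (P.comp (Polynomial.C u * (Polynomial.X + 1))))
        (Polynomial.aeval (C u * (binomialSeries ℤ_[p] f).map (algebraMap ℤ_[p] (PadicAlgCl p))) P)‖ =
        (P.comp (Polynomial.C u * (Polynomial.X + 1))).supNorm ∧
      (∀ k, ‖coeff k (Polynomial.aeval (C u * (binomialSeries ℤ_[p] f).map (algebraMap ℤ_[p] (PadicAlgCl p))) P)‖ ≤
        ‖coeff (p ^ f.valuation * layerLambda (P.comp (Polynomial.C u * (Polynomial.X + 1))))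
          (Polynomial.aeval (C u * (binomialSeries ℤ_[p] f).map (algebraMap ℤ_[p] (PadicAlgCl p))) P)‖) ∧
      ∀ k, k < p ^ f.valuation * layerLambda (P.comp (Polynomial.C u * (Polynomial.X + 1))) →
        ‖coeff k (Polynomial.aeval (C u * (binomialSeries ℤ_[p] f).map (algebraMap ℤ_[p] (PadicAlgCl p))) P)‖ <
          ‖coeff (p ^ f.valuation * layerLambda (P.comp (Polynomial.C u * (Polynomial.X + 1))))
            (Polynomial.aeval (C u * (binomialSeries ℤ_[p] f).map (algebraMap ℤ_[p] (PadicAlgCl p))) P)‖ := by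
  set Y : PowerSeries (PadicAlgCl p) := (binomialSeries ℤ_[p] f).map (algebraMap ℤ_[p] (PadicAlgCl p)) with hY
  set R := P.comp (Polynomial.C u * (Polynomial.X + 1)) with hR
  have hR0 : R ≠ 0 := comp_C_mul_X_add_one_ne_zero hP hu
  have hh : Y - 1 = (binomialSeries ℤ_[p] f - 1).map (algebraMap ℤ_[p] (PadicAlgCl p)) := by
    rw [map_sub, map_one]
  -- `ℤ_p → ℚ̄_p` preserves norms (the tree's `Literature.Algebra.Polynomial.PadicInt.norm_algebraMap_padicAlgCl`, inlined)
  have hnorm : ∀ x : ℤ_[p], ‖algebraMap ℤ_[p] (PadicAlgCl p) x‖ = ‖x‖ := fun x ↦ by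
    rw [IsScalarTower.algebraMap_apply ℤ_[p] ℚ_[p] (PadicAlgCl p), PadicInt.algebraMap_apply]
    exact (PadicAlgCl.norm_extends p (x : ℚ_[p])).trans PadicInt.norm_def.symm
  obtain ⟨h1, hle, hlt⟩ := normLambda_binomialSeries_sub_one (algebraMap ℤ_[p] (PadicAlgCl p)) hnorm hf
  rw [← hh] at h1 hle hlt
  have hn : 0 < p ^ f.valuation := pow_pos (Fact.out : p.Prime).pos _
  obtain ⟨hv, hle', hlt'⟩ := normLambda_aeval hR0 hn h1 hle hlt
  rw [aeval_C_mul_eq_aeval_sub_one_comp, ← hR, mul_comm]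
  exact ⟨hv, hle', hlt'⟩

end Local

/-! ## §3. The full analytic product `C(c)·L·∏_v P_v(u_v·(1+T)^{f_v})` -/

section Product

variable {p : ℕ} [Fact p.Prime]

/-- **E2-num, analytic side.** Let `c ≠ 0`, let `L ≠ 0` attain its maximal coefficient norm first at `d`, and for
`v ∈ s` let `P_v ≠ 0` be polynomials over `ℚ̄_p`, `u_v ≠ 0` scalars and `f_v ∈ ℤ_p ∖ 0`. Then the product
`C c · L · ∏_{v∈s} P_v(u_v·(1+T)^{f_v})` attains its maximal coefficient norm FIRST at
`d + Σ_{v∈s} p^{v_p(f_v)} · layerLambda (P_v.comp (C u_v * (X + 1)))` — so this number IS the λ-invariant that the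
module side (`…RttE2NumLambdaCount`, RTT@2's `finrank_*_quotient_span_eq_of_normLambda`) counts for `Λ_𝒪/(c·L·∏𝒫_v)`;
with `u_v = ℓ_v⁻¹`, `f_v = frobeniusExponent p ℓ_v`, `P_v = 1 − C (embCoeff g ι ℓ_v) X + C c_v X²` it is the E2-tail's
`d + Σ_{v∈S₀} p^{(frobeniusExponent p ℓ_v).valuation}·layerLambda(…)` verbatim.
[cite: GreenbergVatsal2000, §2 Prop. (2.4) and Cor. (2.3)] [cite: Washington1997, §7.1 and §13.2] -/
theorem normLambda_C_mul_mul_prod_aeval {ι : Type*} (s : Finset ι) {c : PadicAlgCl p} (hc : c ≠ 0)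
    {L : PowerSeries (PadicAlgCl p)} (hL : L ≠ 0) {d : ℕ}
    (hle : ∀ k, ‖coeff k L‖ ≤ ‖coeff d L‖) (hlt : ∀ k, k < d → ‖coeff k L‖ < ‖coeff d L‖)
    (P : ι → Polynomial (PadicAlgCl p)) (u : ι → PadicAlgCl p) (f : ι → ℤ_[p])
    (hP : ∀ v ∈ s, P v ≠ 0) (hu : ∀ v ∈ s, u v ≠ 0) (hf : ∀ v ∈ s, f v ≠ 0) :
    let φ : PowerSeries (PadicAlgCl p) := C c * L *
      ∏ v ∈ s, Polynomial.aeval (C (u v) * (binomialSeries ℤ_[p] (f v)).map (algebraMap ℤ_[p] (PadicAlgCl p))) (P v)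
    let D : ℕ := d + ∑ v ∈ s, p ^ (f v).valuation * layerLambda ((P v).comp (Polynomial.C (u v) * (Polynomial.X + 1)))
    ‖coeff D φ‖ = ‖c‖ * ‖coeff d L‖ * ∏ v ∈ s, ((P v).comp (Polynomial.C (u v) * (Polynomial.X + 1))).supNorm ∧
      (∀ k, ‖coeff k φ‖ ≤ ‖coeff D φ‖) ∧ ∀ k, k < D → ‖coeff k φ‖ < ‖coeff D φ‖ := by
  intro φ D
  -- the Euler product
  set Eu : ι → PowerSeries (PadicAlgCl p) := fun v ↦
    Polynomial.aeval (C (u v) * (binomialSeries ℤ_[p] (f v)).map (algebraMap ℤ_[p] (PadicAlgCl p))) (P v) with hEu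
  set e : ι → ℕ := fun v ↦ p ^ (f v).valuation * layerLambda ((P v).comp (Polynomial.C (u v) * (Polynomial.X + 1)))
    with he
  have hloc : ∀ v ∈ s, ‖coeff (e v) (Eu v)‖ = ((P v).comp (Polynomial.C (u v) * (Polynomial.X + 1))).supNorm ∧
      (∀ k, ‖coeff k (Eu v)‖ ≤ ‖coeff (e v) (Eu v)‖) ∧ ∀ k, k < e v → ‖coeff k (Eu v)‖ < ‖coeff (e v) (Eu v)‖ :=
    fun v hv ↦ normLambda_aeval_C_mul_binomialSeries (hP v hv) (hu v hv) (hf v hv)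
  have hEu0 : ∀ v ∈ s, Eu v ≠ 0 := fun v hv h0 ↦ by
    have h := (hloc v hv).1
    rw [h0, map_zero, norm_zero] at h
    exact (Polynomial.supNorm_eq_zero_iff _).not.mpr (comp_C_mul_X_add_one_ne_zero (hP v hv) (hu v hv)) h.symm
  obtain ⟨hprodv, hprodle, hprodlt⟩ := normLambda_prod s Eu e hEu0 (fun v hv ↦ (hloc v hv).2.1) (fun v hv ↦ (hloc v hv).2.2)
  have hprod0 : ∏ v ∈ s, Eu v ≠ 0 := Finset.prod_ne_zero_iff.mpr hEu0
  -- `C c * L`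
  have hcL0 : C c * L ≠ 0 := mul_ne_zero (fun h ↦ hc (by simpa using congrArg (coeff 0) h)) hL
  have hcL : (∀ k, ‖coeff k (C c * L)‖ ≤ ‖coeff d (C c * L)‖) ∧ ∀ k, k < d → ‖coeff k (C c * L)‖ < ‖coeff d (C c * L)‖ :=
    (normLambda_C_mul_iff hc L d).mpr ⟨hle, hlt⟩
  obtain ⟨hv, hle', hlt'⟩ := normLambda_mul hcL0 hprod0 hcL.1 hcL.2 hprodle hprodlt
  refine ⟨?_, hle', hlt'⟩
  rw [hv, hprodv, norm_coeff_C_mul]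
  exact congrArg _ (Finset.prod_congr rfl fun v hv ↦ (hloc v hv).1)

end Product

end Summit.BirchSwinnertonDyer.BirchSwinnertonDyer.Theorems.SmallImageRttE2Num

end
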